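import Literature.AnabelianGeometry.EtaleTheta.FrobenioidThetaDivisorsThm49Stub
import Literature.AlgebraicGeometry.Frobenioids.DivisorMonoidCategoryTheoreticity
import Literature.AlgebraicGeometry.Frobenioids.ModelFrobenioidTypeBridge
import Literature.AlgebraicGeometry.Frobenioids.CoAngular
import HarnessLib

/-!
# [EtTh] Prop. 5.3's "isomorphism of divisor monoids induced by `Ψ`" READ AS [FrdI] Thm. 4.9 — GAP-LEDGER
# G-w5d245-2, LINK (a): the stub predicate `DivisorTransportStub.IsInducedBy` instantiated, and what it yields at
# the root pair `s^⊓_N, s^⊔_N : A_N → B_N`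

S. Mochizuki, *The étale theta function and its Frobenioid-theoretic manifestations*, Publ. RIMS **45** (2009)
[MochizukiEtTh2009], §5: Prop. 5.3 p.325 (PDF p.99) ("the automorphism `Ψ^Φ_{A_⊚}` of the monoid `Φ(A_⊚)`
obtained by composing the isomorphism of divisor monoids induced by `Ψ` [cf. Corollary 3.8, (iii); [FrdI],
Theorem 4.9] with the isomorphism `Φ(Ψ(A_⊚)) ⥲ Φ(A_⊚)` induced by the chosen isomorphism"), Thm. 5.6 proof
p.329 (PDF p.103) ("since `Ψ` [essentially] preserves the divisor of zeroes and poles of `Θ̈` … there exist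
isomorphisms `γ₁ : S₁ → T₁`, `γ₂ : S₂ → T₂` …") [cite: MochizukiEtTh2009, Prop 5.3 p.325 (PDF p.99)];
S. Mochizuki, *The geometry of Frobenioids I* (2008) [MochizukiFrdI2008], Thm. 4.9 p.88 ("there exists an
isomorphism of functors `Ψ^Φ : Φ₁ ⥲ Φ₂` lying over `Ψ`", with — Cor. 4.11 (iv) p.92 — `Div`-compatibility),
Rem. 1.1.1 p.21 (`Div(φ ∘ ψ) = Base(ψ)^* Div(φ) + deg_Fr(φ)·Div(ψ)`).

abc-iut cell, layer L2, seat abc-iut-w6-d052 (gen 6), row R314 of abc-iut-L2-lead = GAP-LEDGER **G-w5d245-2 LINK (a)**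
(abc-iut-w5-d245's bridge «Prop 5.3 (vi) READ AT THE BASE PAIR»: its derivation needs four links the abstract §5
structure does not carry; (a) = "the stub predicate `DivisorTransportStub.IsInducedBy Ψ A e_T` INSTANTIATED as
[FrdI] Thm 4.9's divisor clause").  abc-iut-L2-t4's `FrobenioidThetaDivisors.DivisorTransportStub 𝔉` is a FREE
predicate (`TODO-merge`); the typed Prop. 5.3 (`GeometryOfDivisorsPreserved T 𝔓 Ψ ι e`, F-2497) carries
`induced : T.IsInducedBy Ψ A_⊚ e` and says nothing more about `e` until `T` is instantiated.

CONTENTS (PROOF-ONLY: theorems over this seat's instantiation `DivisorTransportStub.ofThm49 𝔉` of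
`FrobenioidThetaDivisorsThm49Stub.lean` — `IsInducedBy Ψ A e` :⟺ `e` is the `A`-component of an isomorphism of functors
`Ψ^Φ : Φ ⥲ Φ` over `Ψ`, `PreFrobenioidData.DivisorMonoidIsoOver 𝔉.pre 𝔉.pre Ψ`, computing the divisors of pre-steps —
the output shape of the tree's [FrdI] Thm. 4.9 suppliers `exists_divisorMonoidIsoOver_thm49_compat_forall_ofFunctor`
(printed vocabulary) / `exists_thm49_compat_of_sufficesRightEqLeft_weak` (weak vocabulary)):
* consequences at the ROOT PAIR (any `𝔉 : ThetaFrobenioid C D`; `s^⊓_N`, `s^⊔_N` ARE pre-steps —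
  `𝔉.isPreStep_sCap/sCup`): `exists_rootPairTransport_of_isInducedBy` — from `induced` at `A_⊚` ONE monoid
  isomorphism `e_N : Φ(A_N) ⥲ Φ(Ψ(A_N))` with `Div(Ψ s^⊓_N) = e_N (Div s^⊓_N)` AND `Div(Ψ s^⊔_N) = e_N (Div s^⊔_N)`;
  `div_conj_eq_of_div_iso` — the Rem. 1.1.1 bookkeeping `Div(α⁻¹ ∘ Ψ(s) ∘ β) = (α⁻¹)^* Div(Ψ(s))` for anchors
  `α : Ψ(A_N) ⥲ A_N`, `β : Ψ(B_N) ⥲ B_N` once isomorphisms are isometries (`hiso`, [FrdI] Rem. 1.1.1 / Def. 1.2 in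
  a pre-Frobenioid: `PreFrobenioid.isIsometry_of_isIso`); assembled:
  **`exists_div_anchored_rootPair_eq_of_isInducedBy`** — `∃ e_N, Div(α⁻¹ ∘ Ψ(s^⊓_N) ∘ β) = (𝔉.pullIso α)⁻¹ (e_N (Div s^⊓_N))`
  and the same `e_N` for `s^⊔_N` — LINK (a)'s input to the binder `hdiv` of abc-iut-L2-d4's
  `Sec5Thm57.rootTransport_of` (links (b)(c)(d) — `divTheta` ↔ root pair, Prop. 5.3 (i) split, `Aut_C(A_⊚)`-orbit
  lifting — then show that `(pullIso α)⁻¹ ∘ e_N` acts on `{Div s^⊓_N, Div s^⊔_N}` as pull-back along ONE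
  automorphism of `A_N`; not this file);
* satisfiability: `exists_isInducedBy_ofThm49_of_exists` — any Thm. 4.9 supplier output
  `∃ E : DivisorMonoidIsoOver 𝔉.pre 𝔉.pre Ψ, ∀ pre-steps φ, E.iso _ (Div φ) = Div (Ψ φ)` inhabits
  `(ofThm49 𝔉).IsInducedBy Ψ A (E.iso A)` at EVERY object — so taking `GeometryOfDivisorsPreserved (ofThm49 𝔉) …` as a
  hypothesis is not vacuous-making on the `induced` field wherever [FrdI] Thm. 4.9 is available (at
  `ofBiKummerData` / `ofConnectedTemperoidData`: `𝔉.pre = PreFrobenioidData.ofModel …` by `rfl`,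
  `ThetaFrobenioid.ofBiKummerData_pre`, so the `ofFunctor`-suppliers apply verbatim through
  `ModelFrobenioid.ofModel_eq_data`).

HONEST FRAMING: LINK (a) only; the [FrdI] Thm. 4.9 existence itself stays a NAMED INPUT in the supplier's shape (its
hypotheses — `C` a Frobenioid of rationally standard type with perf-factorial `Φ`, [EtTh] Thm. 3.7 (ii) — have their
own rows); nothing of [EtTh] §5 is asserted; no side taken on [IUTchIII] Cor. 3.12; typed ≠ proved — here proved.
-/

namespace Literature.AnabelianGeometry.EtaleTheta

open CategoryTheory Literature.AlgebraicGeometry.Frobenioids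

universe w v v' u u'

variable {C : Type u} [Category.{v} C] {D : Type u'} [Category.{v'} D]

namespace FrobenioidThetaDivisors

variable (𝔉 : ThetaFrobenioid.{w} C D)

/-! ### Consequences of `induced` read as [FrdI] Thm. 4.9 (`DivisorTransportStub.ofThm49`) -/

/-- **Satisfiability of `induced`**: every output of a [FrdI] Thm. 4.9 supplier — an isomorphism of functors over `Ψ`
computing the divisors of pre-steps — inhabits `(ofThm49 𝔉).IsInducedBy Ψ A (E.iso A)` at EVERY object `A`.
[cite: MochizukiFrdI2008, Thm. 4.9 p.88] -/
theorem exists_isInducedBy_ofThm49_of_exists (Ψ : C ≌ C)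
    (h49 : ∃ E : 𝔉.pre.DivisorMonoidIsoOver 𝔉.pre Ψ,
      ∀ ⦃X Y : C⦄ (φ : X ⟶ Y), 𝔉.pre.IsPreStep φ → E.iso X (𝔉.pre.div φ) = 𝔉.pre.div (Ψ.functor.map φ))
    (A : C) :
    ∃ e, (DivisorTransportStub.ofThm49 𝔉).IsInducedBy Ψ A e := by
  obtain ⟨E, hE⟩ := h49
  exact ⟨E.iso A, E, rfl, hE⟩

/-- `induced` at one object propagates to every object: the SAME `Ψ^Φ` has a component everywhere.
[cite: MochizukiFrdI2008, Thm. 4.9 p.88] -/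
theorem exists_isInducedBy_ofThm49_of_isInducedBy {Ψ : C ≌ C} {A : C}
    {e : 𝔉.pre.Mon (𝔉.base.obj A) ≃* 𝔉.pre.Mon (𝔉.base.obj (Ψ.functor.obj A))}
    (h : (DivisorTransportStub.ofThm49 𝔉).IsInducedBy Ψ A e) (X : C) :
    ∃ eX, (DivisorTransportStub.ofThm49 𝔉).IsInducedBy Ψ X eX := by
  obtain ⟨E, -, hE⟩ := h
  exact ⟨E.iso X, E, rfl, hE⟩

/-- The divisor clause at the anchoring object itself: `Div(Ψ φ) = e (Div φ)` for every pre-step `φ` out of `A`.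
[cite: MochizukiFrdI2008, Thm. 4.9 p.88] -/
theorem div_map_eq_of_isInducedBy {Ψ : C ≌ C} {A : C}
    {e : 𝔉.pre.Mon (𝔉.base.obj A) ≃* 𝔉.pre.Mon (𝔉.base.obj (Ψ.functor.obj A))}
    (h : (DivisorTransportStub.ofThm49 𝔉).IsInducedBy Ψ A e) ⦃B : C⦄ (φ : A ⟶ B) (hφ : 𝔉.pre.IsPreStep φ) :
    𝔉.pre.div (Ψ.functor.map φ) = e (𝔉.pre.div φ) := by
  obtain ⟨E, rfl, hE⟩ := h
  exact (hE φ hφ).symm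

/-! ### At the root pair `s^⊓_N, s^⊔_N : A_N → B_N` (pre-steps, [EtTh] Prop. 4.2 (iii)) -/

/-- **From `induced` at `A_⊚`: ONE isomorphism `e_N : Φ(A_N) ⥲ Φ(Ψ(A_N))` transporting BOTH root divisors**,
`Div(Ψ s^⊓_N) = e_N (Div s^⊓_N)` and `Div(Ψ s^⊔_N) = e_N (Div s^⊔_N)` (the `A_N`-component of the same `Ψ^Φ`;
`s^⊓_N`, `s^⊔_N` are pre-steps). [cite: MochizukiEtTh2009, Thm 5.6 p.329 (PDF p.103)] -/
theorem exists_rootPairTransport_of_isInducedBy {Ψ : C ≌ C}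
    {e : 𝔉.PhiAcirc ≃* 𝔉.pre.Mon (𝔉.base.obj (Ψ.functor.obj 𝔉.Acirc))}
    (h : (DivisorTransportStub.ofThm49 𝔉).IsInducedBy Ψ 𝔉.Acirc e) :
    ∃ eN : 𝔉.pre.Mon (𝔉.base.obj 𝔉.AN) ≃* 𝔉.pre.Mon (𝔉.base.obj (Ψ.functor.obj 𝔉.AN)),
      (DivisorTransportStub.ofThm49 𝔉).IsInducedBy Ψ 𝔉.AN eN ∧
      𝔉.pre.div (Ψ.functor.map 𝔉.sCap) = eN (𝔉.pre.div 𝔉.sCap) ∧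
      𝔉.pre.div (Ψ.functor.map 𝔉.sCup) = eN (𝔉.pre.div 𝔉.sCup) := by
  obtain ⟨E, -, hE⟩ := h
  exact ⟨E.iso 𝔉.AN, ⟨E, rfl, hE⟩, (hE 𝔉.sCap 𝔉.isPreStep_sCap).symm, (hE 𝔉.sCup 𝔉.isPreStep_sCup).symm⟩

/-- The Frobenius degree of an isomorphism is `1` ([FrdI] Rem. 1.1.1: `deg_Fr(c⁻¹)·deg_Fr(c) = deg_Fr(id) = 1` in
`ℕ_{≥1}`). [cite: MochizukiFrdI2008, Rem. 1.1.1 p.21] -/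
theorem degFr_hom_eq_one {X Y : C} (c : X ≅ Y) : 𝔉.pre.degFr c.hom = 1 := by
  have h := 𝔉.pre.degFr_comp c.hom c.inv
  rw [c.hom_inv_id, 𝔉.pre.degFr_id] at h
  have h' : ((𝔉.pre.degFr c.hom : ℕ+) : ℕ) * (𝔉.pre.degFr c.inv : ℕ) = 1 := by
    exact_mod_cast h.symm
  exact PNat.coe_inj.mp (Nat.eq_one_of_mul_eq_one_right h')

/-- **[FrdI] Rem. 1.1.1 bookkeeping for an anchored arrow**: if isomorphisms are isometries (`hiso`: [FrdI] Def. 1.2 /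
Rem. 1.1.1 in a pre-Frobenioid — `PreFrobenioid.isIsometry_of_isIso`), then for anchors `α : Ψ(A_N) ⥲ A_N`,
`β : Ψ(B_N) ⥲ B_N` and any `ψ : Ψ(A_N) → Ψ(B_N)`, `Div(α⁻¹ ∘ ψ ∘ β) = (α⁻¹)^* Div(ψ) = (𝔉.pullIso α)⁻¹ (Div ψ)`.
[cite: MochizukiFrdI2008, Rem. 1.1.1 p.21] -/
theorem div_conj_eq_of_div_iso (hiso : ∀ ⦃X Y : C⦄ (c : X ≅ Y), 𝔉.pre.div c.hom = 1)
    {Ψ : C ≌ C} (α : Ψ.functor.obj 𝔉.AN ≅ 𝔉.AN) (β : Ψ.functor.obj 𝔉.BN ≅ 𝔉.BN)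
    (ψ : Ψ.functor.obj 𝔉.AN ⟶ Ψ.functor.obj 𝔉.BN) :
    𝔉.pre.div (α.inv ≫ ψ ≫ β.hom) = (𝔉.pullIso α).symm (𝔉.pre.div ψ) := by
  have hβ : 𝔉.pre.div (ψ ≫ β.hom) = 𝔉.pre.div ψ := by
    rw [𝔉.pre.div_comp, hiso β, map_one, one_mul, degFr_hom_eq_one 𝔉 β, PNat.one_coe, pow_one]
  have hα : 𝔉.pre.div α.inv = 1 := hiso α.symm
  rw [𝔉.pre.div_comp, hβ, hα, one_pow, mul_one]
  rfl

/-- **LINK (a) at the base pair, assembled**: from `induced` at `A_⊚` (read as [FrdI] Thm. 4.9) and "isomorphisms are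
isometries", for ANY anchors `α : Ψ(A_N) ⥲ A_N`, `β : Ψ(B_N) ⥲ B_N` there is ONE monoid isomorphism
`e_N : Φ(A_N) ⥲ Φ(Ψ(A_N))` with
`Div(α⁻¹ ∘ Ψ(s^⊓_N) ∘ β) = (pullIso α)⁻¹ (e_N (Div s^⊓_N))` and `Div(α⁻¹ ∘ Ψ(s^⊔_N) ∘ β) = (pullIso α)⁻¹ (e_N (Div s^⊔_N))`
— the two anchored divisors of abc-iut-L2-d4's binder `hdiv` are the images of the two root divisors under the SAME
isomorphism `(pullIso α)⁻¹ ∘ e_N`.  (Links (b)(c)(d) of G-w5d245-2 then identify this isomorphism on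
`{Div s^⊓_N, Div s^⊔_N}` with pull-back along an automorphism of `A_N`.) [cite: MochizukiEtTh2009, Thm 5.6 p.329 (PDF p.103)] -/
theorem exists_div_anchored_rootPair_eq_of_isInducedBy (hiso : ∀ ⦃X Y : C⦄ (c : X ≅ Y), 𝔉.pre.div c.hom = 1)
    {Ψ : C ≌ C} {e : 𝔉.PhiAcirc ≃* 𝔉.pre.Mon (𝔉.base.obj (Ψ.functor.obj 𝔉.Acirc))}
    (h : (DivisorTransportStub.ofThm49 𝔉).IsInducedBy Ψ 𝔉.Acirc e)
    (α : Ψ.functor.obj 𝔉.AN ≅ 𝔉.AN) (β : Ψ.functor.obj 𝔉.BN ≅ 𝔉.BN) :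
    ∃ eN : 𝔉.pre.Mon (𝔉.base.obj 𝔉.AN) ≃* 𝔉.pre.Mon (𝔉.base.obj (Ψ.functor.obj 𝔉.AN)),
      (DivisorTransportStub.ofThm49 𝔉).IsInducedBy Ψ 𝔉.AN eN ∧
      𝔉.pre.div (α.inv ≫ Ψ.functor.map 𝔉.sCap ≫ β.hom) = (𝔉.pullIso α).symm (eN (𝔉.pre.div 𝔉.sCap)) ∧
      𝔉.pre.div (α.inv ≫ Ψ.functor.map 𝔉.sCup ≫ β.hom) = (𝔉.pullIso α).symm (eN (𝔉.pre.div 𝔉.sCup)) := by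
  obtain ⟨eN, hN, hcap, hcup⟩ := exists_rootPairTransport_of_isInducedBy 𝔉 h
  refine ⟨eN, hN, ?_, ?_⟩
  · rw [div_conj_eq_of_div_iso 𝔉 hiso, hcap]
  · rw [div_conj_eq_of_div_iso 𝔉 hiso, hcup]

/-- **The naturality that comes with `induced`**: the components `e = Ψ^Φ_{A_⊚}` and `e_N = Ψ^Φ_{A_N}` of ONE `Ψ^Φ`
are compatible with pull-back along every arrow between `A_N` and `A_⊚` (both directions) — the coherence links (b)/(d)
of G-w5d245-2 use when moving `div(Θ̈) ∈ Φ(A_⊚)^gp` to the root pair. [cite: MochizukiFrdI2008, Thm. 4.9 p.88] -/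
theorem exists_rootPairTransport_natural_of_isInducedBy {Ψ : C ≌ C}
    {e : 𝔉.PhiAcirc ≃* 𝔉.pre.Mon (𝔉.base.obj (Ψ.functor.obj 𝔉.Acirc))}
    (h : (DivisorTransportStub.ofThm49 𝔉).IsInducedBy Ψ 𝔉.Acirc e) :
    ∃ eN : 𝔉.pre.Mon (𝔉.base.obj 𝔉.AN) ≃* 𝔉.pre.Mon (𝔉.base.obj (Ψ.functor.obj 𝔉.AN)),
      𝔉.pre.div (Ψ.functor.map 𝔉.sCap) = eN (𝔉.pre.div 𝔉.sCap) ∧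
      𝔉.pre.div (Ψ.functor.map 𝔉.sCup) = eN (𝔉.pre.div 𝔉.sCup) ∧
      (∀ (φ : 𝔉.AN ⟶ 𝔉.Acirc) (x : 𝔉.PhiAcirc),
        eN (𝔉.pre.pull (𝔉.base.map φ) x) = 𝔉.pre.pull (𝔉.base.map (Ψ.functor.map φ)) (e x)) ∧
      ∀ (φ : 𝔉.Acirc ⟶ 𝔉.AN) (y : 𝔉.pre.Mon (𝔉.base.obj 𝔉.AN)),
        e (𝔉.pre.pull (𝔉.base.map φ) y) = 𝔉.pre.pull (𝔉.base.map (Ψ.functor.map φ)) (eN y) := by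
  obtain ⟨E, rfl, hE⟩ := h
  exact ⟨E.iso 𝔉.AN, (hE 𝔉.sCap 𝔉.isPreStep_sCap).symm, (hE 𝔉.sCup 𝔉.isPreStep_sCup).symm,
    fun φ x => E.natural φ x, fun φ y => E.natural φ y⟩


/-! ### Satisfiability in the supplier's own currency and at the model presentation -/

/-- **`induced` from a [FrdI] Thm. 4.9 supplier stated over ANY presentation `p` of the operations** (`hp : 𝔉.pre = p`;
e.g. `p := PreFrobenioidData.ofModel …` with `hp := ThetaFrobenioid.ofBiKummerData_pre`, i.e. `rfl`, at the assembled
§5 data `ofBiKummerData` / `ofConnectedTemperoidData`). [cite: MochizukiFrdI2008, Thm. 4.9 p.88] -/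
theorem exists_isInducedBy_ofThm49_of_pre_eq {p : PreFrobenioidData.{w} C D} (hp : 𝔉.pre = p) (Ψ : C ≌ C)
    (h49 : ∃ E : p.DivisorMonoidIsoOver p Ψ,
      ∀ ⦃X Y : C⦄ (φ : X ⟶ Y), p.IsPreStep φ → E.iso X (p.div φ) = p.div (Ψ.functor.map φ))
    (A : C) :
    ∃ e, (DivisorTransportStub.ofThm49 𝔉).IsInducedBy Ψ A e := by
  subst hp
  exact exists_isInducedBy_ofThm49_of_exists 𝔉 Ψ h49 A

/-- "Isomorphisms are isometries" (`hiso`) over ANY presentation `p` of the operations that IS a pre-Frobenioid through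
the tree's functor form: if `𝔉.pre = PreFrobenioidData.ofFunctor Φ F` with `F` a pre-Frobenioid ([FrdI] Def. 1.1:
`Φ` divisorial, hence sharp), then `Div(c) = 0` for every isomorphism `c` (`PreFrobenioid.isIsometry_of_isIso`).
[cite: MochizukiFrdI2008, Rem. 1.1.1 p.21] -/
theorem div_iso_eq_one_of_pre_eq_ofFunctor {Φ : Dᵒᵖ ⥤ CommMonCat.{w}} {F : C ⥤ ElemFrobenioid Φ}
    (hp : 𝔉.pre = PreFrobenioidData.ofFunctor Φ F) (hP : IsPreFrobenioid Φ F)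
    ⦃X Y : C⦄ (c : X ≅ Y) : 𝔉.pre.div c.hom = 1 := by
  rw [hp]
  exact PreFrobenioid.isIsometry_of_isIso F hP c.hom

end FrobenioidThetaDivisors

/-! ### The MODEL presentation (`𝔉.pre = PreFrobenioidData.ofModel Φ B DivB`, e.g. `ofBiKummerData` by `rfl`) -/

namespace ThetaFrobenioid

open FrobenioidThetaDivisors

variable {Φ B : Dᵒᵖ ⥤ CommMonCat.{w}} {DivB : B ⟶ monoidGp Φ}
  (𝔉 : ThetaFrobenioid.{w} (ModelFrobenioid Φ B DivB) D)

/-- **`induced` (read as [FrdI] Thm. 4.9) IS INHABITED at §5 data whose operations are the MODEL's** —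
`h𝔉 : 𝔉.pre = PreFrobenioidData.ofModel Φ B DivB` (at `ofBiKummerData` this is `ofBiKummerData_pre`, `rfl`) — from the
output of the tree's Thm. 4.9 suppliers IN THEIR OWN SHAPE over `PreFrobenioidData.ofFunctor Φ (ModelFrobenioid.toElem …)`
(`exists_divisorMonoidIsoOver_thm49_compat_forall_ofFunctor`, printed vocabulary;
`exists_thm49_compat_of_sufficesRightEqLeft_weak`, weak vocabulary; their hypotheses — a Frobenioid of rationally standard
type with perf-factorial `Φ`, [EtTh] Thm. 3.7 (i)(ii) — are those rows' business): `ofModel = ofFunctor ∘ toElem`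
definitionally (`ModelFrobenioid.ofModel_eq_data`). [cite: MochizukiFrdI2008, Thm. 4.9 p.88] -/
theorem exists_isInducedBy_ofThm49_of_model (h𝔉 : 𝔉.pre = PreFrobenioidData.ofModel Φ B DivB)
    (Ψ : ModelFrobenioid Φ B DivB ≌ ModelFrobenioid Φ B DivB)
    (h49 : ∃ E : (PreFrobenioidData.ofFunctor Φ (ModelFrobenioid.toElem Φ B DivB)).DivisorMonoidIsoOver
        (PreFrobenioidData.ofFunctor Φ (ModelFrobenioid.toElem Φ B DivB)) Ψ,
      ∀ ⦃X Y : ModelFrobenioid Φ B DivB⦄ (φ : X ⟶ Y), PreFrobenioid.IsPreStep (ModelFrobenioid.toElem Φ B DivB) φ →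
        E.iso X (PreFrobenioid.Div (ModelFrobenioid.toElem Φ B DivB) φ) =
          PreFrobenioid.Div (ModelFrobenioid.toElem Φ B DivB) (Ψ.functor.map φ))
    (A : ModelFrobenioid Φ B DivB) :
    ∃ e, (DivisorTransportStub.ofThm49 𝔉).IsInducedBy Ψ A e :=
  exists_isInducedBy_ofThm49_of_pre_eq 𝔉 (h𝔉.trans (ModelFrobenioid.ofModel_eq_data Φ B DivB)) Ψ h49 A

/-- At the model presentation with `C → F_Φ` a pre-Frobenioid ([FrdI] Thm. 5.2 (ii) supplies even "Frobenioid"),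
isomorphisms are isometries — the `hiso` input of `exists_div_anchored_rootPair_eq_of_isInducedBy` DISCHARGED.
[cite: MochizukiFrdI2008, Rem. 1.1.1 p.21] -/
theorem div_iso_eq_one_of_model (h𝔉 : 𝔉.pre = PreFrobenioidData.ofModel Φ B DivB)
    (hP : IsPreFrobenioid Φ (ModelFrobenioid.toElem Φ B DivB))
    ⦃X Y : ModelFrobenioid Φ B DivB⦄ (c : X ≅ Y) : 𝔉.pre.div c.hom = 1 :=
  div_iso_eq_one_of_pre_eq_ofFunctor 𝔉 (h𝔉.trans (ModelFrobenioid.ofModel_eq_data Φ B DivB)) hP c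

/-- **LINK (a) at the model presentation, end to end**: for §5 data with the model's operations (`ofBiKummerData`:
`rfl`), `C → F_Φ` a pre-Frobenioid, and `Ψ`, `e` with `induced : (ofThm49 𝔉).IsInducedBy Ψ A_⊚ e` (the field of the
typed Prop. 5.3 / F-2497 once `T := ofThm49 𝔉`): for ANY anchors `α : Ψ(A_N) ⥲ A_N`, `β : Ψ(B_N) ⥲ B_N` there is ONE
`e_N : Φ(A_N) ⥲ Φ(Ψ(A_N))`, itself `Ψ`-induced, with `Div(α⁻¹ ∘ Ψ(s) ∘ β) = (pullIso α)⁻¹ (e_N (Div s))` for BOTH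
`s = s^⊓_N, s^⊔_N`. [cite: MochizukiEtTh2009, Thm 5.6 p.329 (PDF p.103)] -/
theorem exists_div_anchored_rootPair_eq_of_model (h𝔉 : 𝔉.pre = PreFrobenioidData.ofModel Φ B DivB)
    (hP : IsPreFrobenioid Φ (ModelFrobenioid.toElem Φ B DivB))
    {Ψ : ModelFrobenioid Φ B DivB ≌ ModelFrobenioid Φ B DivB}
    {e : 𝔉.PhiAcirc ≃* 𝔉.pre.Mon (𝔉.base.obj (Ψ.functor.obj 𝔉.Acirc))}
    (h : (DivisorTransportStub.ofThm49 𝔉).IsInducedBy Ψ 𝔉.Acirc e)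
    (α : Ψ.functor.obj 𝔉.AN ≅ 𝔉.AN) (β : Ψ.functor.obj 𝔉.BN ≅ 𝔉.BN) :
    ∃ eN : 𝔉.pre.Mon (𝔉.base.obj 𝔉.AN) ≃* 𝔉.pre.Mon (𝔉.base.obj (Ψ.functor.obj 𝔉.AN)),
      (DivisorTransportStub.ofThm49 𝔉).IsInducedBy Ψ 𝔉.AN eN ∧
      𝔉.pre.div (α.inv ≫ Ψ.functor.map 𝔉.sCap ≫ β.hom) = (𝔉.pullIso α).symm (eN (𝔉.pre.div 𝔉.sCap)) ∧
      𝔉.pre.div (α.inv ≫ Ψ.functor.map 𝔉.sCup ≫ β.hom) = (𝔉.pullIso α).symm (eN (𝔉.pre.div 𝔉.sCup)) :=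
  exists_div_anchored_rootPair_eq_of_isInducedBy 𝔉 (div_iso_eq_one_of_model 𝔉 h𝔉 hP) h α β

end ThetaFrobenioid

end Literature.AnabelianGeometry.EtaleTheta
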